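import Summits.AtomisticToContinuum.Crystallization.Theorems.SquareWellLayerCakeStackingFaultSparsityOfLaminarBarlowWindows

/-!
# Crux `StackingFaultSparsity` (stmt-AtomisticToContinuum-14296): the unconditional fault bill

The checked line `Sketch` (`Cruxes/StackingFaultSparsity/Lines/Sketch.lean`) proves the crux
`StackingFaultSparsity` of the routes `SquareWellLayerCake` / `LaminarSixThreeThree` from registered
stubs, all of which have landed except the X-type input `stub_coarsening` (whose unconditional form is
the open item stmt-AtomisticToContinuum-14292, `LaminarBarlowWindows`).  The landed conditional closure
`StackingFaultSparsity_of_laminarBarlowWindows` (`…OfLaminarBarlowWindows.lean`) consumes the GLOBAL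
hypothesis `LaminarBarlowWindows` (all ground-state sequences, all scales).

This file records the two sharper forms of what the line proves WITHOUT any hypothesis, so that any
route producing Barlow windows — at one scale with a rate, or along one sequence only — can consume the
stacking-selection mechanism directly:

* `faultBill` — **finite `N`, every ground state, no limit**: for every `R, ε` there are `C ≥ 0` and
  `L₂` such that for every scale `L ≥ L₂` some tolerance `ε' ∈ (0, ε/2]` satisfies, for EVERY `N` and
  every Lennard-Jones ground state `x` of `N` particles,
  `#{i : (R,ε)-Barlow-but-not-hcp window} ≤ #{i : no (L,ε')-Barlow window} + C·N/L`.
  (Stacking faults are billed to non-crystallinity at scale `L` plus a `C/L` density: the union bound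
  over the split `Bad ⊆ ¬BarlowM(L,ε') ∪ [BarlowM(L,ε') ∧ ¬HcpM(R,ε)]` and the landed
  `selection_count`, i.e. dilute faults + scale pinning + the certified off-box gap + covering.)
* `stackingFaultSparsity_seq` — **per sequence**: for ONE sequence of ground states, Barlow windows at
  every scale in density (`¬BarlowM(L,ε')` has density `→ 0` for all `L, ε'`) imply that the
  Barlow-but-not-hcp windows have density `→ 0` for all `R, ε` (the landed global implication
  `crux_of_laminarBarlowWindows` is the special case where the hypothesis holds for every sequence).

All `[folklore]` glue over the landed files; nothing here closes the item (it stays X-type).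
-/

noncomputable section

open scoped Topology
open Filter
open Literature.MathematicalPhysics.StatisticalMechanics
open Summit.AtomisticToContinuum.Crystallization.Theorems.SquareWellLayerCake.StackingFaultSparsity
open Summit.AtomisticToContinuum.Crystallization.Theorems.SquareWellLayerCake.StackingFaultSparsity.OfLaminarBarlowWindows
  (selection_count natCard_le_add)

namespace Summit.AtomisticToContinuum.Crystallization.Theorems.SquareWellLayerCake.StackingFaultSparsity.FaultBill

/-- **The fault bill (finite `N`, unconditional).** For every `R > 0`, `ε ∈ (0, 1/4)` there are
`C ≥ 0` and `L₂` such that for every `L ≥ L₂`, `L > 0`, some `ε' ∈ (0, ε/2]` makes the following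
hold for EVERY `N` and every Lennard-Jones ground state `x`: the number of particles whose
`R`-window is `(R, ε)`-matched to some Barlow stacking but to no hcp stacking is at most the number
of particles WITHOUT an `(L, ε')`-Barlow window plus `C·N/L`. [folklore] -/
theorem faultBill :
    ∀ R ε : ℝ, 0 < R → 0 < ε → ε < 1 / 4 →
    ∃ C : ℝ, 0 ≤ C ∧ ∃ L₂ : ℝ, ∀ L : ℝ, L₂ ≤ L → 0 < L → ∃ ε' : ℝ, 0 < ε' ∧ ε' ≤ ε / 2 ∧
      ∀ (N : ℕ) (x : Fin N → EuclideanSpace ℝ (Fin 3)), IsGroundState lennardJones x →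
        (Nat.card {i : Fin N // BarlowM R ε x i ∧ ¬ HcpM R ε x i} : ℝ) ≤
          Nat.card {i : Fin N // ¬ BarlowM L ε' x i} + C * N / L := by
  intro R ε hR hε hε4
  obtain ⟨C, hC0, L₂, hsel⟩ := selection_count R ε hR hε hε4
  refine ⟨C, hC0, L₂, fun L hL hLpos => ?_⟩
  obtain ⟨ε', hε'pos, hε'le, hcount⟩ := hsel L hL hLpos
  refine ⟨ε', hε'pos, hε'le, fun N x hx => ?_⟩
  have hsplit : (Nat.card {i : Fin N // BarlowM R ε x i ∧ ¬ HcpM R ε x i} : ℝ) ≤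
      (Nat.card {i : Fin N // ¬ BarlowM L ε' x i} : ℝ)
        + (Nat.card {i : Fin N // BarlowM L ε' x i ∧ ¬ HcpM R ε x i} : ℝ) := by
    exact_mod_cast natCard_le_add (N := N)
      (P := fun i => BarlowM R ε x i ∧ ¬ HcpM R ε x i)
      (Q₁ := fun i => ¬ BarlowM L ε' x i)
      (Q₂ := fun i => BarlowM L ε' x i ∧ ¬ HcpM R ε x i)
      (fun i hi => by
        by_cases hB : BarlowM L ε' x i
        · exact Or.inr ⟨hB, hi.2⟩
        · exact Or.inl hB)
  have hc := hcount N x hx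
  linarith

/-- **Stacking-fault sparsity along ONE sequence of ground states with Barlow windows at every
scale.** If, along the ground-state sequence `x`, for every scale `L > 0` and tolerance
`ε' ∈ (0, 1/4)` the particles without an `(L, ε')`-Barlow window have density `→ 0`, then for every
`R > 0`, `ε ∈ (0, 1/4)` the particles with an `(R, ε)`-Barlow but no `(R, ε)`-hcp window have density
`→ 0`. (From `faultBill`: `limsup ≤ C/L` for every large `L`.) [folklore] -/
theorem stackingFaultSparsity_seq :
    ∀ x : (N : ℕ) → (Fin N → EuclideanSpace ℝ (Fin 3)), (∀ N, IsGroundState lennardJones (x N)) →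
    (∀ L ε' : ℝ, 0 < L → 0 < ε' → ε' < 1 / 4 →
      Tendsto (fun N : ℕ => (Nat.card {i : Fin N // ¬ BarlowM L ε' (x N) i} : ℝ) / N) atTop (𝓝 0)) →
    ∀ R ε : ℝ, 0 < R → 0 < ε → ε < 1 / 4 →
    Tendsto (fun N : ℕ =>
      (Nat.card {i : Fin N // BarlowM R ε (x N) i ∧ ¬ HcpM R ε (x N) i} : ℝ) / N) atTop (𝓝 0) := by
  intro x hx hX R ε hR hε hε4
  obtain ⟨C, hC0, L₂, hbill⟩ := faultBill R ε hR hε hε4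
  refine Summit.AtomisticToContinuum.Crystallization.Theorems.certificatesDefectVanish_tendsto_zero
    (fun N => by positivity) fun η hη => ?_
  -- choose the scale: `C / L ≤ η / 2`
  set L : ℝ := max (max L₂ 1) (2 * C / η) with hLdef
  have hL₂ : L₂ ≤ L := (le_max_left _ _).trans (le_max_left _ _)
  have hL1 : (1 : ℝ) ≤ L := (le_max_right _ _).trans (le_max_left _ _)
  have hLpos : 0 < L := by linarith
  have hCL : C / L ≤ η / 2 := by
    rw [div_le_iff₀ hLpos]
    have : 2 * C / η ≤ L := le_max_right _ _
    rw [div_le_iff₀ hη] at this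
    linarith
  obtain ⟨ε', hε'pos, hε'le, hcount⟩ := hbill L hL₂ hLpos
  have hε'4 : ε' < 1 / 4 := by linarith
  -- the coarse part, along this sequence
  have hco := hX L ε' hLpos hε'pos hε'4
  have hco' : ∀ᶠ N : ℕ in atTop,
      (Nat.card {i : Fin N // ¬ BarlowM L ε' (x N) i} : ℝ) / N ≤ η / 2 :=
    (hco.eventually (Iic_mem_nhds (show (0 : ℝ) < η / 2 by positivity))).mono fun N hN => hN
  filter_upwards [hco', eventually_gt_atTop 0] with N hN hNpos
  have hNr : (0 : ℝ) < N := by exact_mod_cast hNpos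
  have hb := hcount N (x N) (hx N)
  rw [div_le_iff₀ hNr] at hN ⊢
  have h2 : C * N / L = (C / L) * N := by ring
  rw [h2] at hb
  have h3 : (C / L) * N ≤ (η / 2) * N := mul_le_mul_of_nonneg_right hCL hNr.le
  linarith

end Summit.AtomisticToContinuum.Crystallization.Theorems.SquareWellLayerCake.StackingFaultSparsity.FaultBill

end
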